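import Summits.CriticalPhenomena.SAWScalingLimit.Theorems.SAWDefectDecoherenceBoundaryClosureRLocalL1Poincare
import Summits.CriticalPhenomena.SAWScalingLimit.Theorems.SAWDefectDecoherenceBoundaryClosureRBoundaryBookkeepingPath
import HarnessLib

/-!
# A discrete Poincaré inequality for potentials on boxes sitting ON a flat floor
(crux `BoundaryClosureR`, stmt-CriticalPhenomena-14004, line `pick-half-plane`, engine input;
registered sub-goal `pickEngine_poincareFloor`)

Landing target:
`Summits/CriticalPhenomena/SAWScalingLimit/Theorems/SAWDefectDecoherenceBoundaryClosureRPoincareFloor.lean`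
(`--supports stmt-CriticalPhenomena-14004`).

Worker w-locall1's `potential_box_poincare` (`…LocalL1Poincare.lean`) bounds the pair oscillation
`Σ_{s,s' ∈ B} ‖H s − H s'‖` of a potential `H` of `F dz` on a box of INTERIOR sites by
`2 · #B · max N₀ N₁ · Σ_{s ∈ B} (‖edgeValue F s 5‖ + ‖edgeValue F s 0‖)`.  Up to the flat pieces the
engine needs boxes whose bottom row consists of FLOOR SITES, which are not interior.  Here: the box
of sites `![x₀ + i, mr + j]`, `i < N₀`, `j < N₁ + 1`, whose bottom row `j = 0` lies on an exact
flat floor of row `mr` (no-pinch form) and whose rows `j ≥ 1` are interior.  The steps of `H` are: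
along the floor row the exact floor steps `(mid(floorEdge k mr) − c(upFace k mr))·F(floorEdge k mr)`
(`BoundaryExactness.potential_floor_step`, from `IsPotential` at the up-face); from row `1` down to
row `0` the spoke `3` (`= s − e₁`) at the interior row-`1` site; inside the rows `≥ 1` the spokes
`5` and `0` as in `potential_box_poincare` (`potential_spoke`).  The generic pair inequality
`LocalL1.box_poincare_pairs` then gives

`Σ_{s,s' ∈ B} ‖H s − H s'‖ ≤ 2 · #B · max N₀ (N₁+1) · ( Σ_{i<N₀} (‖floor step (x₀+i)‖ +
  ‖edgeValue F ![x₀+i, mr+1] 3‖) + Σ_{i<N₀} Σ_{j<N₁} (‖edgeValue F ![x₀+i, mr+1+j] 5‖ +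
  ‖edgeValue F ![x₀+i, mr+1+j] 0‖) )`

(`potential_floorBox_poincare`; registry form `pickEngine_poincareFloor`).  With
`‖edgeValue F s k‖ = ‖F(edge_k)‖/(2√3)` (`LocalL1.norm_edgeValue`) and
`‖mid − c_up‖ = 1/(2√3)` every step norm is an arrival modulus `‖F(e)‖/(2√3)` of a mid-edge near the
box.  Sources: H. Duminil-Copin, S. Smirnov, Ann. of Math. 175 (2012), §4 (the map `H`).
-/

noncomputable section

open scoped BigOperators
open Finset
open Literature.Probability.LatticeModels Literature.Probability.RandomPlanarGeometry
open Literature.Probability.RandomPlanarGeometry.SAW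
open Literature.Barriers.CriticalPhenomena
open Summit.CriticalPhenomena.SAWScalingLimit.Theorems.PickHalfPlane.LocalL1
  (box_poincare_pairs site_succ_fst site_succ_snd)
open Summit.CriticalPhenomena.SAWScalingLimit.Theorems.PickHalfPlane.BoundaryExactness
  (potential_floor_step)

namespace Summit.CriticalPhenomena.SAWScalingLimit.Theorems.PickHalfPlane.GateMass

/-! ### 19. Box parametrisation: the downward spoke and the floor row -/

/-- The site below `![x, y + (j+1)]` is its spoke `3` (`= s − e₁`). [folklore] -/
theorem site_pred_snd (x₀ y₀ : ℤ) (i j : ℕ) :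
    (![x₀ + (i : ℤ), y₀ + (j : ℤ)] : Site 2) = spoke ![x₀ + (i : ℤ), y₀ + ((j + 1 : ℕ) : ℤ)] 3 := by
  ext k
  fin_cases k
  · simp [spoke, Matrix.vecHead, Matrix.vecTail]
  · simp [spoke, Matrix.vecHead, Matrix.vecTail]; ring

/-- The bottom row of the box in floor coordinates: `![x₀ + (i+1), mr + 0] = ![(x₀ + i) + 1, mr]`
and `![x₀ + i, mr + 0] = ![x₀ + i, mr]`. [folklore] -/
theorem site_floor_row (x₀ mr : ℤ) (i : ℕ) :
    (![x₀ + ((i + 1 : ℕ) : ℤ), mr + ((0 : ℕ) : ℤ)] : Site 2) = ![x₀ + (i : ℤ) + 1, mr] ∧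
      (![x₀ + (i : ℤ), mr + ((0 : ℕ) : ℤ)] : Site 2) = ![x₀ + (i : ℤ), mr] := by
  constructor
  · ext k; fin_cases k
    · simp; ring
    · simp
  · ext k; fin_cases k
    · simp
    · simp

/-! ### 20. The Poincaré inequality on a floor box -/

/-- **Discrete Poincaré inequality for a potential on a box sitting on a flat floor.**  For a
potential `H` of `F dz` (`IsPotential Λ a H`, `F = F(a, ·, x_c, 5/8)`), the box of sites
`![x₀ + i, mr + j]`, `i < N₀`, `j < N₁ + 1`, whose bottom row lies on an exact (no-pinch) flat floor
of row `mr` over the columns `x₀ … x₀ + N₀` and whose rows `j ≥ 1` are interior sites: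
`Σ_{s,s' ∈ B} ‖H s − H s'‖ ≤ 2 · #B · max N₀ (N₁+1) · (Σ_{i<N₀} (‖floor step (x₀+i)‖ +
‖edgeValue F ![x₀+i, mr+1] 3‖) + Σ_{i<N₀} Σ_{j<N₁} (‖edgeValue F ![x₀+i, mr+(j+1)] 5‖ +
‖edgeValue F ![x₀+i, mr+(j+1)] 0‖))`. [cite: DuminilCopinSmirnov2012, §4 (the map H with dH = F dz)] -/
theorem potential_floorBox_poincare {Λ : Finset HexVertex} {a : Sym2 HexVertex} {H : Site 2 → ℂ}
    (hH : IsPotential Λ a H) (x₀ mr : ℤ) (N₀ N₁ : ℕ)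
    (hfloor : ∀ k : ℤ, x₀ ≤ k → k ≤ x₀ + N₀ → ((![k, mr], 0) : HexVertex) ∈ Λ ∧
      ((![k, mr - 1], 1) : HexVertex) ∉ Λ ∧ (k < x₀ + N₀ → ((![k, mr], 1) : HexVertex) ∈ Λ) ∧
      ((![k, mr - 1], 0) : HexVertex) ∉ Λ)
    (hint : ∀ i j : ℕ, i < N₀ → 1 ≤ j → j < N₁ + 1 →
      IsInteriorSite Λ ![x₀ + (i : ℤ), mr + (j : ℤ)]) :
    ∑ i ∈ range N₀, ∑ j ∈ range (N₁ + 1), ∑ i' ∈ range N₀, ∑ j' ∈ range (N₁ + 1),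
        ‖H ![x₀ + (i : ℤ), mr + (j : ℤ)] - H ![x₀ + (i' : ℤ), mr + (j' : ℤ)]‖ ≤
      2 * ((N₀ * (N₁ + 1) : ℕ) : ℝ) * ((max N₀ (N₁ + 1) : ℕ) : ℝ) *
        (∑ i ∈ range N₀,
            (‖(hexMidpoint (floorEdge (x₀ + (i : ℤ)) mr) - hexCenter (upFace (x₀ + (i : ℤ)) mr)) *
                hexParafermionicObservable Λ a hexCriticalFugacity (5 / 8) (floorEdge (x₀ + (i : ℤ)) mr)‖ +
              ‖edgeValue (hexParafermionicObservable Λ a hexCriticalFugacity (5 / 8))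
                ![x₀ + (i : ℤ), mr + ((1 : ℕ) : ℤ)] 3‖) +
          ∑ i ∈ range N₀, ∑ j ∈ range N₁,
            (‖edgeValue (hexParafermionicObservable Λ a hexCriticalFugacity (5 / 8))
                ![x₀ + (i : ℤ), mr + ((j + 1 : ℕ) : ℤ)] 5‖ +
              ‖edgeValue (hexParafermionicObservable Λ a hexCriticalFugacity (5 / 8))
                ![x₀ + (i : ℤ), mr + ((j + 1 : ℕ) : ℤ)] 0‖)) := by
  set F := hexParafermionicObservable Λ a hexCriticalFugacity (5 / 8) with hF
  set u : ℕ → ℕ → ℂ := fun i j => H ![x₀ + (i : ℤ), mr + (j : ℤ)] with hu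
  -- step weights
  set fl : ℕ → ℝ := fun i =>
    ‖(hexMidpoint (floorEdge (x₀ + (i : ℤ)) mr) - hexCenter (upFace (x₀ + (i : ℤ)) mr)) *
      F (floorEdge (x₀ + (i : ℤ)) mr)‖ with hfl
  set dn : ℕ → ℝ := fun i => ‖edgeValue F ![x₀ + (i : ℤ), mr + ((1 : ℕ) : ℤ)] 3‖ with hdn
  set A : ℕ → ℕ → ℝ := fun i j => ‖edgeValue F ![x₀ + (i : ℤ), mr + ((j + 1 : ℕ) : ℤ)] 5‖ with hA
  set Bv : ℕ → ℕ → ℝ := fun i j => ‖edgeValue F ![x₀ + (i : ℤ), mr + ((j + 1 : ℕ) : ℤ)] 0‖ with hB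
  have hfl0 : ∀ i, 0 ≤ fl i := fun i => norm_nonneg _
  have hdn0 : ∀ i, 0 ≤ dn i := fun i => norm_nonneg _
  have hA0 : ∀ i j, 0 ≤ A i j := fun i j => norm_nonneg _
  have hB0 : ∀ i j, 0 ≤ Bv i j := fun i j => norm_nonneg _
  -- the floor row: exact floor steps
  have hrow0 : ∀ i ∈ range (N₀ - 1), ‖u (i + 1) 0 - u i 0‖ = fl i := by
    intro i hi
    rw [mem_range] at hi
    have hup : upFace (x₀ + (i : ℤ)) mr ∈ Λ := (hfloor (x₀ + (i : ℤ)) (by omega) (by omega)).1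
    simp only [hu, hfl]
    rw [(site_floor_row x₀ mr i).1, (site_floor_row x₀ mr i).2, potential_floor_step hH hup]
  -- rows `≥ 1`: spoke `5`
  have hrow : ∀ j ∈ range N₁, ∀ i ∈ range (N₀ - 1), ‖u (i + 1) (j + 1) - u i (j + 1)‖ = A i j := by
    intro j hj i hi
    rw [mem_range] at hi hj
    have hs := hint i (j + 1) (by omega) (by omega) (by omega)
    simp only [hu, hA]
    rw [site_succ_fst, potential_spoke hH hs 5]
  -- from row `1` down to the floor: spoke `3` at the row-`1` site
  have hcol0 : ∀ i ∈ range N₀, 1 ≤ N₁ → ‖u i (0 + 1) - u i 0‖ = dn i := by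
    intro i hi hN
    rw [mem_range] at hi
    have hs := hint i 1 hi le_rfl (by omega)
    simp only [hu, hdn, zero_add]
    rw [norm_sub_rev, site_pred_snd x₀ mr i 0, potential_spoke hH hs 3]
  -- between rows `≥ 1`: spoke `0`
  have hcol : ∀ i ∈ range N₀, ∀ j ∈ range (N₁ - 1), ‖u i (j + 1 + 1) - u i (j + 1)‖ = Bv i j := by
    intro i hi j hj
    rw [mem_range] at hi hj
    have hs := hint i (j + 1) hi (by omega) (by omega)
    simp only [hu, hB]
    rw [site_succ_snd, potential_spoke hH hs 0]
  -- the row sums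
  have h1 : ∑ j ∈ range (N₁ + 1), ∑ i ∈ range (N₀ - 1), ‖u (i + 1) j - u i j‖ ≤
      ∑ i ∈ range N₀, fl i + ∑ i ∈ range N₀, ∑ j ∈ range N₁, A i j := by
    rw [sum_range_succ', add_comm]
    refine add_le_add ?_ ?_
    · calc ∑ i ∈ range (N₀ - 1), ‖u (i + 1) 0 - u i 0‖ = ∑ i ∈ range (N₀ - 1), fl i :=
            sum_congr rfl fun i hi => hrow0 i hi
        _ ≤ ∑ i ∈ range N₀, fl i :=
            sum_le_sum_of_subset_of_nonneg (range_subset_range.2 (Nat.sub_le N₀ 1))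
              fun i _ _ => hfl0 i
    · calc ∑ j ∈ range N₁, ∑ i ∈ range (N₀ - 1), ‖u (i + 1) (j + 1) - u i (j + 1)‖
          = ∑ j ∈ range N₁, ∑ i ∈ range (N₀ - 1), A i j :=
            sum_congr rfl fun j hj => sum_congr rfl fun i hi => hrow j hj i hi
        _ = ∑ i ∈ range (N₀ - 1), ∑ j ∈ range N₁, A i j := sum_comm
        _ ≤ ∑ i ∈ range N₀, ∑ j ∈ range N₁, A i j :=
            sum_le_sum_of_subset_of_nonneg (range_subset_range.2 (Nat.sub_le N₀ 1))
              fun i _ _ => sum_nonneg fun j _ => hA0 i j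
  -- the column sums
  have h2 : ∑ i ∈ range N₀, ∑ j ∈ range (N₁ + 1 - 1), ‖u i (j + 1) - u i j‖ ≤
      ∑ i ∈ range N₀, dn i + ∑ i ∈ range N₀, ∑ j ∈ range N₁, Bv i j := by
    rw [← sum_add_distrib]
    refine sum_le_sum fun i hi => ?_
    rw [Nat.add_sub_cancel]
    rcases Nat.eq_zero_or_pos N₁ with hN | hN
    · subst hN
      simp only [range_zero, sum_empty, add_zero]
      exact hdn0 i
    · obtain ⟨n, rfl⟩ : ∃ n, N₁ = n + 1 := ⟨N₁ - 1, by omega⟩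
      rw [sum_range_succ']
      rw [add_comm]
      refine add_le_add ?_ ?_
      · rw [hcol0 i hi hN]
      · calc ∑ j ∈ range n, ‖u i (j + 1 + 1) - u i (j + 1)‖ = ∑ j ∈ range n, Bv i j :=
              sum_congr rfl fun j hj => hcol i hi j (by rw [Nat.add_sub_cancel]; exact hj)
          _ ≤ ∑ j ∈ range (n + 1), Bv i j :=
              sum_le_sum_of_subset_of_nonneg (range_subset_range.2 (Nat.le_succ n))
                fun j _ _ => hB0 i j
  -- assemble
  have hmax0 : (N₀ : ℝ) ≤ ((max N₀ (N₁ + 1) : ℕ) : ℝ) := by exact_mod_cast le_max_left N₀ (N₁ + 1)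
  have hmax1 : ((N₁ + 1 : ℕ) : ℝ) ≤ ((max N₀ (N₁ + 1) : ℕ) : ℝ) := by
    exact_mod_cast le_max_right N₀ (N₁ + 1)
  set ROWS := ∑ i ∈ range N₀, fl i + ∑ i ∈ range N₀, ∑ j ∈ range N₁, A i j with hROWS
  set COLS := ∑ i ∈ range N₀, dn i + ∑ i ∈ range N₀, ∑ j ∈ range N₁, Bv i j with hCOLS
  have hROWS0 : 0 ≤ ROWS := by
    rw [hROWS]
    exact add_nonneg (sum_nonneg fun i _ => hfl0 i)
      (sum_nonneg fun i _ => sum_nonneg fun j _ => hA0 i j)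
  have hCOLS0 : 0 ≤ COLS := by
    rw [hCOLS]
    exact add_nonneg (sum_nonneg fun i _ => hdn0 i)
      (sum_nonneg fun i _ => sum_nonneg fun j _ => hB0 i j)
  have htot : ∑ i ∈ range N₀, (fl i + dn i) + ∑ i ∈ range N₀, ∑ j ∈ range N₁, (A i j + Bv i j) =
      ROWS + COLS := by
    rw [hROWS, hCOLS]
    simp only [sum_add_distrib]
    ring
  calc ∑ i ∈ range N₀, ∑ j ∈ range (N₁ + 1), ∑ i' ∈ range N₀, ∑ j' ∈ range (N₁ + 1),
        ‖u i j - u i' j'‖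
      ≤ ((N₀ * (N₁ + 1) : ℕ) : ℝ) *
          (N₀ * ∑ j ∈ range (N₁ + 1), ∑ i ∈ range (N₀ - 1), ‖u (i + 1) j - u i j‖ +
            ((N₁ + 1 : ℕ) : ℝ) * ∑ i ∈ range N₀, ∑ j ∈ range (N₁ + 1 - 1), ‖u i (j + 1) - u i j‖) := by
        have := box_poincare_pairs u N₀ (N₁ + 1)
        push_cast at this ⊢
        exact this
    _ ≤ ((N₀ * (N₁ + 1) : ℕ) : ℝ) *
          (((max N₀ (N₁ + 1) : ℕ) : ℝ) * ROWS + ((max N₀ (N₁ + 1) : ℕ) : ℝ) * COLS) := by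
        refine mul_le_mul_of_nonneg_left (add_le_add ?_ ?_) (Nat.cast_nonneg _)
        · exact mul_le_mul hmax0 h1 (sum_nonneg fun j _ => sum_nonneg fun i _ => norm_nonneg _)
            ((Nat.cast_nonneg _).trans hmax0)
        · exact mul_le_mul hmax1 h2 (sum_nonneg fun i _ => sum_nonneg fun j _ => norm_nonneg _)
            ((Nat.cast_nonneg _).trans hmax1)
    _ = 1 * (((N₀ * (N₁ + 1) : ℕ) : ℝ) * ((max N₀ (N₁ + 1) : ℕ) : ℝ) * (ROWS + COLS)) := by ring
    _ ≤ 2 * (((N₀ * (N₁ + 1) : ℕ) : ℝ) * ((max N₀ (N₁ + 1) : ℕ) : ℝ) * (ROWS + COLS)) := by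
        refine mul_le_mul_of_nonneg_right (by norm_num) ?_
        have : 0 ≤ ((max N₀ (N₁ + 1) : ℕ) : ℝ) := Nat.cast_nonneg _
        positivity
    _ = _ := by rw [← htot]; ring

/-- **Registered sub-goal `pickEngine_poincareFloor`** (crux item stmt-CriticalPhenomena-14004, line
`pick-half-plane`, engine input): the discrete Poincaré inequality for a potential of `F dz` on a
box sitting on an exact flat floor (bottom row = floor sites, rows `≥ 1` interior), in registry
form (one `∀`-term; see `potential_floorBox_poincare`).
[cite: DuminilCopinSmirnov2012, §4 (the map H with dH = F dz)] -/
theorem pickEngine_poincareFloor : ∀ (Λ : Finset HexVertex) (a : Sym2 HexVertex) (H : Site 2 → ℂ), IsPotential Λ a H → ∀ (x₀ mr : ℤ) (N₀ N₁ : ℕ), (∀ k : ℤ, x₀ ≤ k → k ≤ x₀ + N₀ → ((![k, mr], 0) : HexVertex) ∈ Λ ∧ ((![k, mr - 1], 1) : HexVertex) ∉ Λ ∧ (k < x₀ + N₀ → ((![k, mr], 1) : HexVertex) ∈ Λ) ∧ ((![k, mr - 1], 0) : HexVertex) ∉ Λ) → (∀ i j : ℕ, i < N₀ → 1 ≤ j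 → j < N₁ + 1 → IsInteriorSite Λ ![x₀ + (i : ℤ), mr + (j : ℤ)]) → ∑ i ∈ Finset.range N₀, ∑ j ∈ Finset.range (N₁ + 1), ∑ i' ∈ Finset.range N₀, ∑ j' ∈ Finset.range (N₁ + 1), ‖H ![x₀ + (i : ℤ), mr + (j : ℤ)] - H ![x₀ + (i' : ℤ), mr + (j' : ℤ)]‖ ≤ 2 * ((N₀ * (N₁ + 1) : ℕ) : ℝ) * ((max N₀ (N₁ + 1) : ℕ) : ℝ) * (∑ i ∈ Finset.range N₀, (‖(hexMidpoint (floorEdge (x₀ + (i : ℤ)) mr) - hexCenter (upFace (x₀ + (i : ℤ)) mr)) * hexParafermionicObservable Λ a hexCriticalFugacity (5 / 8) (floorEdge (x₀ + (i : ℤ)) mr)‖ + ‖edgeValue (hexParafermionicObservable Λ a hexCriticalFugacity (5 / 8)) ![x₀ + (i : ℤ), mr + ((1 : ℕ) : ℤ)] 3‖) + ∑ i ∈ Finset.range N₀, ∑ j ∈ Finset.range N₁, (‖edgeValue (hexParafermionicObservable Λ a hexCriticalFugacity (5 / 8)) ![x₀ + (i : ℤ), mr + ((j + 1 : ℕ)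 : ℤ)] 5‖ + ‖edgeValue (hexParafermionicObservable Λ a hexCriticalFugacity (5 / 8)) ![x₀ + (i : ℤ), mr + ((j + 1 : ℕ) : ℤ)] 0‖)) :=
  fun _ _ _ hH x₀ mr N₀ N₁ hfloor hint => potential_floorBox_poincare hH x₀ mr N₀ N₁ hfloor hint

end Summit.CriticalPhenomena.SAWScalingLimit.Theorems.PickHalfPlane.GateMass

end
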